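/-
Copyright (c) 2026 the pub-hodgecm-mathlib formalisation cell (harness21).  Prover seat hodgecm-mathlib-K2E5-p08 (g2), Track B «K2-LIT» ∕ h413,
engine E5 «TamagawaUnitary», support of socket G5 `sig_K2E5NrdDescent` ∕ G6 `sig_K2E5NrdImageCovol` (unit G «ZETA»), ED. 2 of the Nrd-image road
(local half): AT EVERY FINITE PLACE THE REDUCED NORM OF THE MATRIX MODEL IS ONTO `L⁺_vˣ`.  2026-09-03.
-/
import Summits.HodgeConjecture.HodgeConjecture.Theorems.K2E5QuatLocalNrdDefs            -- ★ #3f-bis (p855295, K2E5-p12): `quatLocalNrd`, `fixedUnits`, `range_quatLocalNrd_le_fixedUnits`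
import Summits.HodgeConjecture.HodgeConjecture.Theorems.K2E5DetHermitianDiagonalBasis   -- ★ B1 (p854960, this base g0): a diagonal frame `ᵗP̄ h P = diag(a, b)`
import Literature.NumberTheory.K2Lit.QuaternionLocalNormOneSurjective                   -- ★ #3h (p855268, K2E5-p14) §1: `exists_quaternary_eq` (quaternary forms over `K_v` are universal)
import Literature.NumberTheory.Rogawski1990.SingularLocalRealisation                    -- ★ `exists_toLocalRing_eq_of_conjLocal_eq` (`(c ⊗ 1)`-fixed ⇒ from `L⁺_v`)
import Literature.NumberTheory.Automorphic.QuadraticHeckeCharacterCM                    -- ★ `cmQuadraticGenerator_spec` (`L = L⁺(δ)`, `δ̄ = −δ`, `δ² = θ ∈ L⁺`)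
import Literature.NumberTheory.Weil1982.UnitaryFinTopFormDualLatticeCompact             -- ★ `localForm_eq_map`, `conjLocal_conjLocal`
import HarnessLib

/-!
# K2 ∕ E5 «TamagawaUnitary», unit G (ZETA), support of G5∕G6 — `K2E5QuatLocalNrdSurjective`:
# **at every finite place `v` of `L⁺` the local reduced norm `Nrd = det : (D_{h,v})^× → E_vˣ` of the matrix model is ONTO `L⁺_vˣ`**
# (`range (quatLocalNrd L h v) = fixedUnits L v`), division places included

Cell `hodgecm-mathlib` (Track B «K2-LIT»), engine E5, item h413 = `stmt-HodgeConjecture-24833`; PROOF lane, helper file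
(`--supports stmt-HodgeConjecture-24833 --as helper`; theorems only: no `def`, no instance, no notation, no named fact, no `sorry`); ED. 2 (local half)
of the road announced with ★ `K2E5QuatAdelicNrdSurjectiveOpen` (ED. 1, structure theorem), dealt BY NAME by K2E5-plan (g0) in DEALS E5 BATCH #6 (c)
(«all finite places ONTO `fixedUnits`»); author K2E5-p08 (g2).  This is the matrix-model form of ★ #3h `K2Lit.QuaternionLocalNormOneSurjective.localReducedNorm_surjective`
(stated there in the abstract frame `K_v ⊗_K D`), i.e. [VignerasLNM800, Ch. II §1 p. 31 (3), Lemme 1.4: `n(H_vˣ) = K_vˣ` at a finite place].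

THE MATHEMATICS.  `L` CM with conjugation `c`, `K = L⁺`, `v` a finite place of `K`, `E_v = Π_{w∣v} L_w` (★ `UnitaryGroup.LocalRing`) with `σ = c ⊗ 1` (★ `conjLocal`)
and `ι : K_v → E_v` (★ `toLocalRing`); `h = Ha` hermitian non-degenerate, `D_v = {x ∈ M₂(E_v) | ᵗ(σx) h = h · adj x}` (★ #3f `quatLocal`), `Nrd = det` (★ #3f-bis `quatLocalNrd`).
* §1 TRANSPORT OF THE MODEL UNDER A CHANGE OF FRAME (any commutative ring `R`, ring endomorphism `σ`, `P ∈ GL₂(R)`): `x ∈ D(σ, ᵗ(σP) H P) ⟹ P x P⁻¹ ∈ D(σ, H)`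
  (`conj_mem_quatModel`; `adj (P x P⁻¹) = P (adj x) P⁻¹` from `adj P = det P · P⁻¹`).
* §2 THE DIAGONAL MODEL (any `R`, `σ` involutive, `σ a = a`, `σ e = e`): the matrices `x(α, γ) = [[α, −e σγ], [γ, σα]]` lie in `D(σ, diag(a, a e))` and
  `det x(α, γ) = α σα + e γ σγ` (`modelElt_mem_quatModel_diagonal`, `det_modelElt`) — the classical presentation `D = E ⊕ E j`, `j² = −e`, `Nrd(α + γ j) = N(α) + e N(γ)`.
* §3 AT A FINITE PLACE (`exists_quatLocalNrd_eq`, **`range_quatLocalNrd_eq_fixedUnits`**): a `σ`-fixed unit `t` of `E_v` is `ι τ` (★ `exists_toLocalRing_eq_of_conjLocal_eq`);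
  take a diagonal frame `ᵗP̄ h P = diag(a, b)`, `a, b ∈ L⁺ˣ` (★ B1 `detHermitianDiagonalBasis`), `e = b∕a`, and `L = L⁺(δ)` with `δ̄ = −δ`, `δ² = θ` (★ `cmQuadraticGenerator_spec`);
  for `α = ι p + ι q · δ`, `γ = ι r + ι s · δ` one has `N(α) = ι(p² − θ q²)`, so `det x(α, γ) = ι(p² − θ q² + e r² − e θ s²)` — a NON-DEGENERATE DIAGONAL QUATERNARY FORM
  over `K_v`, hence universal (★ #3h §1 `exists_quaternary_eq` = [Serre1973, Ch. IV §2.2 Thm. 6 (iv), Cor.]): choose `(p, q, r, s)` with value `τ`; then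
  `y = P_v · x · P_v⁻¹ ∈ D_v` (§1, ★ `localForm_eq_map`) is invertible with `det y = ι τ = t`.  With ★ `range_quatLocalNrd_le_fixedUnits`: `Nrd((D_v)^×) = L⁺_vˣ`.

HONEST LABEL: HC_CM is proved only modulo the 7 printed citations (2 remaining named inputs: hLiu418 = stmt-HodgeConjecture-24832,
h413 = stmt-HodgeConjecture-24833) until rung 0 closes; this helper closes no socket and changes no count.

## References
* [VignerasLNM800] M.-F. Vignéras, *Arithmétique des algèbres de quaternions*, LNM 800 (1980) — Ch. I §1 p. 3 (`{E, e}`-presentation, `n(α + jγ)`), Ch. II §1 p. 31 (3), Lemme 1.4.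
* [Serre1973] J.-P. Serre, *A Course in Arithmetic*, GTM 7 (1973) — Ch. IV §2.2 Thm. 6 (iv) and Corollary.
* [PlatonovRapinchuk1994] V. Platonov, A. Rapinchuk, *Algebraic Groups and Number Theory* (1994) — §1.4.3 (reduced norm of quaternion algebras over local fields), §2.3.
* [Rogawski1990] J. D. Rogawski, *Automorphic Representations of Unitary Groups in Three Variables* (1990) — §1.9 p. 9, §3.8.
-/

set_option autoImplicit false
set_option linter.dupNamespace false

noncomputable section

namespace Summit.HodgeConjecture.HodgeConjecture.Cruxes.H413.K2E5QuatLocalNrdSurjective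

open NumberField IsDedekindDomain
open Literature.NumberTheory.Automorphic Literature.NumberTheory.Automorphic.UnitaryGroup
open Literature.NumberTheory.Weil1982.UnitaryFinTopForm
open Summit.HodgeConjecture.HodgeConjecture.Cruxes.H413.K2E5QuatAdelicMatrixModel
open Summit.HodgeConjecture.HodgeConjecture.Cruxes.H413.K2E5QuatLocalMeasure
open Summit.HodgeConjecture.HodgeConjecture.Cruxes.H413.K2E5QuatLocalNrd
open scoped Matrix MatrixGroups

/-! ## §1 Transport of the matrix model under a change of frame -/

section Transport

variable {R : Type*} [CommRing R] (σ : R →+* R)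

/-- For `P ∈ GL₂(R)`: `adj P = det P · P⁻¹` (from `P · adj P = det P · 1`). [folklore] -/
theorem adjugate_coe_eq_det_smul_inv (P : GL (Fin 2) R) :
    Matrix.adjugate (P : Matrix (Fin 2) (Fin 2) R) = (P : Matrix (Fin 2) (Fin 2) R).det • ((P⁻¹ : GL (Fin 2) R) : Matrix (Fin 2) (Fin 2) R) := by
  calc Matrix.adjugate (P : Matrix (Fin 2) (Fin 2) R)
      = ((P⁻¹ : GL (Fin 2) R) : Matrix (Fin 2) (Fin 2) R) * ((P : Matrix (Fin 2) (Fin 2) R) * Matrix.adjugate (P : Matrix (Fin 2) (Fin 2) R)) := by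
        rw [← Matrix.mul_assoc, ← Units.val_mul, inv_mul_cancel, Units.val_one, Matrix.one_mul]
    _ = (P : Matrix (Fin 2) (Fin 2) R).det • ((P⁻¹ : GL (Fin 2) R) : Matrix (Fin 2) (Fin 2) R) := by
        rw [Matrix.mul_adjugate, Matrix.mul_smul, Matrix.mul_one]

/-- **Change of frame**: if `x ∈ D(σ, ᵗ(σP) H P)` then `P x P⁻¹ ∈ D(σ, H)` (★ #3d `quatModel`; `ᵗ(σ(PxP⁻¹)) H = ᵗ(σP⁻¹) ᵗ(σx) ᵗ(σP) H = H · P (adj x) P⁻¹ = H · adj(PxP⁻¹)`).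
Equivalent hermitian forms have conjugate quaternion models. [cite: PlatonovRapinchuk1994, §2.3 (equivalent forms, conjugate groups)] [cite: VignerasLNM800, Ch. I §1 p. 3] -/
theorem conj_mem_quatModel (P : GL (Fin 2) R) (H : Matrix (Fin 2) (Fin 2) R) {x : Matrix (Fin 2) (Fin 2) R}
    (hx : x ∈ quatModel σ ((((P : Matrix (Fin 2) (Fin 2) R)).map σ)ᵀ * H * (P : Matrix (Fin 2) (Fin 2) R))) :
    (P : Matrix (Fin 2) (Fin 2) R) * x * ((P⁻¹ : GL (Fin 2) R) : Matrix (Fin 2) (Fin 2) R) ∈ quatModel σ H := by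
  set p : Matrix (Fin 2) (Fin 2) R := (P : Matrix (Fin 2) (Fin 2) R) with hp
  set q : Matrix (Fin 2) (Fin 2) R := ((P⁻¹ : GL (Fin 2) R) : Matrix (Fin 2) (Fin 2) R) with hq
  have hpq : p * q = 1 := by rw [hp, hq, ← Units.val_mul, mul_inv_cancel, Units.val_one]
  have hqp : q * p = 1 := by rw [hp, hq, ← Units.val_mul, inv_mul_cancel, Units.val_one]
  have hadjp : Matrix.adjugate p = p.det • q := adjugate_coe_eq_det_smul_inv P
  have hadjq : Matrix.adjugate q = q.det • p := by
    have h := adjugate_coe_eq_det_smul_inv P⁻¹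
    rw [inv_inv] at h
    exact h
  have hdet : q.det * p.det = 1 := by rw [← Matrix.det_mul, hqp, Matrix.det_one]
  have hσ1 : (q.map σ)ᵀ * (p.map σ)ᵀ = 1 := by
    rw [← Matrix.transpose_mul, ← Matrix.map_mul, hpq, Matrix.map_one σ (map_zero σ) (map_one σ), Matrix.transpose_one]
  rw [mem_quatModel_iff] at hx ⊢
  -- `ᵗ(σx) ᵗ(σp) H = ᵗ(σp) H p (adj x) q`
  have hx' : (x.map σ)ᵀ * ((p.map σ)ᵀ * H) = (p.map σ)ᵀ * H * p * Matrix.adjugate x * q := by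
    have h := congrArg (· * q) hx
    simp only [Matrix.mul_assoc] at h ⊢
    rw [hpq, Matrix.mul_one] at h
    exact h
  have hadj : Matrix.adjugate (p * x * q) = p * Matrix.adjugate x * q := by
    simp only [Matrix.adjugate_mul_distrib, hadjp, hadjq, Matrix.smul_mul, Matrix.mul_smul, smul_smul, Matrix.mul_assoc]
    rw [mul_comm, hdet, one_smul]
  calc ((p * x * q).map σ)ᵀ * H
      = (q.map σ)ᵀ * ((x.map σ)ᵀ * ((p.map σ)ᵀ * H)) := by
        rw [Matrix.map_mul, Matrix.map_mul, Matrix.transpose_mul, Matrix.transpose_mul]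
        simp only [Matrix.mul_assoc]
    _ = (q.map σ)ᵀ * (p.map σ)ᵀ * (H * p * Matrix.adjugate x * q) := by rw [hx']; simp only [Matrix.mul_assoc]
    _ = H * Matrix.adjugate (p * x * q) := by rw [hσ1, Matrix.one_mul, hadj]; simp only [Matrix.mul_assoc]

end Transport

/-! ## §2 The diagonal model `D(σ, diag(a, a e)) ∋ [[α, −e σγ], [γ, σα]]` and its reduced norm `N(α) + e N(γ)` -/

section Diagonal

variable {R : Type*} [CommRing R] (σ : R →+* R)

/-- **The `{E, e}`-presentation of the diagonal model**: for `σ` involutive, `σ e = e`, and any `a, α, γ ∈ R`, the matrix `[[α, −e·σγ], [γ, σα]]`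
lies in `D(σ, diag(a, a e)) = {x | ᵗ(σx) diag(a, a e) = diag(a, a e) adj x}` (★ #3d `quatModel`). [cite: VignerasLNM800, Ch. I §1 p. 3 (M(α + jγ), j² = −e)] -/
theorem modelElt_mem_quatModel_diagonal (hσ : ∀ r, σ (σ r) = r) (a : R) {e : R} (he : σ e = e) (α γ : R) :
    !![α, -(e * σ γ); γ, σ α] ∈ quatModel σ (Matrix.diagonal ![a, a * e]) := by
  rw [mem_quatModel_iff, Matrix.adjugate_fin_two_of]
  ext i j
  fin_cases i <;> fin_cases j <;>
    simp [Matrix.mul_apply, Matrix.diagonal, Matrix.map_apply, map_neg, map_mul, hσ, he] <;> ring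

/-- `det [[α, −e·σγ], [γ, σα]] = α·σα + e·(γ·σγ)` — the reduced norm `N(α) + e N(γ)` of `α + jγ`. [cite: VignerasLNM800, Ch. I §1 p. 3 (n(h) = n(a) − j² n(b))] -/
theorem det_modelElt (e α γ : R) : (!![α, -(e * σ γ); γ, σ α]).det = α * σ α + e * (γ * σ γ) := by
  rw [Matrix.det_fin_two_of]
  ring

end Diagonal

/-! ## §3 At a finite place: `Nrd((D_v)^×) = L⁺_vˣ` -/

section Local

variable (L : Type) [Field L] [NumberField L] [IsCMField L] (Ha : Matrix (Fin 2) (Fin 2) L) (v : HeightOneSpectrum (𝓞 ↥(maximalRealSubfield L)))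

/-- **Every element of `L⁺_vˣ` is a local reduced norm**: for `t ∈ E_vˣ` fixed by `c ⊗ 1` there is `y ∈ (D_v)^×` with `Nrd y = det y = t` — division places included
(quaternary forms over `K_v` are universal). [cite: VignerasLNM800, Ch. II §1 p. 31 (3), Lemme 1.4] [cite: Serre1973, Ch. IV §2.2 Thm. 6 (iv), Cor.]
[cite: PlatonovRapinchuk1994, §1.4.3] -/
theorem exists_quatLocalNrd_eq (hHa : (Ha.map (cmConjRingHom L)).transpose = Ha) (hdet : Ha.det ≠ 0)
    {t : (LocalRing L v)ˣ} (ht : t ∈ fixedUnits L v) :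
    ∃ y : ↥(quatLocalUnits L Ha v), quatLocalNrd L Ha v y = t := by
  classical
  -- the currency: `σ = c ⊗ 1` on `E_v`, `f : L → E_v`, `ι : K_v → E_v` (`K = L⁺`)
  set c := IsCMField.complexConj L with hc
  set σ : LocalRing L v →+* LocalRing L v := conjLocal L c v with hσdef
  set f : L →+* LocalRing L v := algebraMap L (LocalRing L v) with hf
  set ι : v.adicCompletion ↥(maximalRealSubfield L) →+* LocalRing L v := toLocalRing L v with hι
  have hσσ : ∀ z, σ (σ z) = z := conjLocal_conjLocal L v
  have hσι : ∀ r, σ (ι r) = ι r := fun r => conjLocal_toLocalRing c v r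
  have hσf : ∀ z : L, σ (f z) = f (cmConjRingHom L z) := fun z => conjLocal_algebraMap c v z
  have hfι : ∀ r : ↥(maximalRealSubfield L), f (algebraMap ↥(maximalRealSubfield L) L r) =
      ι (algebraMap ↥(maximalRealSubfield L) (v.adicCompletion ↥(maximalRealSubfield L)) r) := fun r => (toLocalRing_coe L v r).symm
  have hKinj : Function.Injective (algebraMap ↥(maximalRealSubfield L) (v.adicCompletion ↥(maximalRealSubfield L))) :=
    (algebraMap ↥(maximalRealSubfield L) (v.adicCompletion ↥(maximalRealSubfield L))).injective
  -- (1) `t = ι τ`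
  obtain ⟨τ, hτ⟩ := Literature.NumberTheory.Rogawski1990.exists_toLocalRing_eq_of_conjLocal_eq v ((mem_fixedUnits_iff L v t).1 ht)
  change ι τ = (t : LocalRing L v) at hτ
  -- (2) a diagonal frame `ᵗP̄ h P = diag(a, b)` with `a, b ∈ L⁺ˣ`; `e = b / a`
  obtain ⟨P, a, b, ha, hb, ha0, hb0, hP⟩ := K2E5DetHermitianDiagonalBasis.detHermitianDiagonalBasis L Ha hHa hdet
  have haR : a ∈ maximalRealSubfield L := (IsCMField.complexConj_eq_self_iff L a).1 ha
  have hbR : b ∈ maximalRealSubfield L := (IsCMField.complexConj_eq_self_iff L b).1 hb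
  set aR : ↥(maximalRealSubfield L) := ⟨a, haR⟩ with haRdef
  set bR : ↥(maximalRealSubfield L) := ⟨b, hbR⟩ with hbRdef
  have haR0 : aR ≠ 0 := fun h => ha0 (congrArg Subtype.val h)
  have hbR0 : bR ≠ 0 := fun h => hb0 (congrArg Subtype.val h)
  set eR : ↥(maximalRealSubfield L) := bR / aR with heRdef
  have heR0 : eR ≠ 0 := div_ne_zero hbR0 haR0
  have haeb : aR * eR = bR := by rw [heRdef, mul_div_cancel₀ _ haR0]
  have haeb' : a * (eR : L) = b := by
    have h := congrArg Subtype.val haeb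
    rwa [Subfield.coe_mul] at h
  -- the scalars of the frame in `K_v`
  set av : v.adicCompletion ↥(maximalRealSubfield L) := algebraMap ↥(maximalRealSubfield L) (v.adicCompletion ↥(maximalRealSubfield L)) aR with havdef
  set ev : v.adicCompletion ↥(maximalRealSubfield L) := algebraMap ↥(maximalRealSubfield L) (v.adicCompletion ↥(maximalRealSubfield L)) eR with hevdef
  have hev : ev ≠ 0 := fun h => heR0 (hKinj (by rw [map_zero]; exact h))
  have hfa : f a = ι av := hfι aR
  have hfb : f b = ι av * ι ev := by
    rw [havdef, hevdef, ← map_mul, ← map_mul, haeb, ← hfι]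
    rfl
  -- (3) `L = L⁺(δ)`, `δ̄ = −δ`, `δ² = θ`
  obtain ⟨δ, hδ0, hcδ, hδsq⟩ := cmQuadraticGenerator_spec L
  set θv : v.adicCompletion ↥(maximalRealSubfield L) :=
    algebraMap ↥(maximalRealSubfield L) (v.adicCompletion ↥(maximalRealSubfield L)) (cmQuadraticGenerator L : ↥(maximalRealSubfield L)) with hθvdef
  have hθ0 : (cmQuadraticGenerator L : ↥(maximalRealSubfield L)) ≠ 0 := by
    intro h
    rw [h, map_zero, sq_eq_zero_iff] at hδsq
    exact hδ0 hδsq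
  have hθv : θv ≠ 0 := fun h => hθ0 (hKinj (by rw [map_zero]; exact h))
  have hδδ : f δ * f δ = ι θv := by
    rw [← map_mul, ← sq, hδsq]
    exact hfι _
  have hσδ : σ (f δ) = -f δ := by rw [hσf, cmConjRingHom_apply, hcδ, map_neg]
  -- the norm form `N(ι p + ι q δ) = ι (p² − θ q²)`
  have hN : ∀ p q : v.adicCompletion ↥(maximalRealSubfield L), (ι p + ι q * f δ) * σ (ι p + ι q * f δ) = ι (p ^ 2 - θv * q ^ 2) := by
    intro p q
    have h1 : σ (ι p + ι q * f δ) = ι p - ι q * f δ := by rw [map_add, map_mul, hσι, hσι, hσδ]; ring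
    have h2 : (ι p + ι q * f δ) * (ι p - ι q * f δ) = ι p ^ 2 - ι q ^ 2 * (f δ * f δ) := by ring
    rw [h1, h2, hδδ, map_sub, map_pow, map_mul, map_pow]
    ring
  -- (4) the quaternary equation `p² − θ q² + e r² − e θ s² = τ` over `K_v` (★ #3h §1: universal)
  obtain ⟨p, q, r, s, hpqrs⟩ := Literature.NumberTheory.K2Lit.QuaternionLocalNormOneSurjective.exists_quaternary_eq ↥(maximalRealSubfield L) v
    (a₁ := 1) (a₂ := -θv) (a₃ := ev) (a₄ := -(ev * θv)) one_ne_zero (neg_ne_zero.2 hθv) hev (neg_ne_zero.2 (mul_ne_zero hev hθv)) τ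
  -- (5) the element `x(α, γ)` of the diagonal model; `det x = ι τ`
  set α : LocalRing L v := ι p + ι q * f δ with hαdef
  set γ : LocalRing L v := ι r + ι s * f δ with hγdef
  set x : Matrix (Fin 2) (Fin 2) (LocalRing L v) := !![α, -(ι ev * σ γ); γ, σ α] with hxdef
  have hxD : x ∈ quatModel σ (Matrix.diagonal ![ι av, ι av * ι ev]) := modelElt_mem_quatModel_diagonal σ hσσ _ (hσι _) α γ
  have hdetx : x.det = ι τ := by
    rw [hxdef, det_modelElt, hαdef, hγdef, hN, hN, ← map_mul, ← map_add, ← hpqrs]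
    congr 1
    ring
  -- (6) the frame over `E_v`: `ᵗ(σP_v) H_v P_v = diag(ι a, ι a · ι e)` (★ `localForm_eq_map`)
  obtain ⟨Pv, hPv⟩ : ∃ Pv : GL (Fin 2) (LocalRing L v), Pv.val = (P : Matrix (Fin 2) (Fin 2) L).map f :=
    ⟨Matrix.GeneralLinearGroup.map f P, rfl⟩
  have hframe : (Pv.val.map σ)ᵀ * localForm L 2 Ha v * Pv.val = Matrix.diagonal ![ι av, ι av * ι ev] := by
    have hmaps : ((P : Matrix (Fin 2) (Fin 2) L).map f).map σ = ((P : Matrix (Fin 2) (Fin 2) L).map (cmConjRingHom L)).map f := by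
      rw [Matrix.map_map, Matrix.map_map]
      exact congrArg _ (funext fun z => hσf z)
    rw [localForm_eq_map L 2 Ha v, hPv, hmaps, ← Matrix.transpose_map, ← Matrix.map_mul, ← Matrix.map_mul, hP, Matrix.diagonal_map (map_zero f)]
    congr 1
    funext i
    fin_cases i
    · exact hfa
    · exact hfb
  -- (7) transport to `D_v` (§1)
  have hyD : Pv.val * x * (Pv⁻¹).val ∈ quatLocal L Ha v := by
    have hx' : x ∈ quatModel σ ((Pv.val.map σ)ᵀ * localForm L 2 Ha v * Pv.val) := by rw [hframe]; exact hxD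
    exact conj_mem_quatModel σ Pv (localForm L 2 Ha v) hx'
  -- (8) the invertible element `y = P_v x P_v⁻¹` of `D_v` with `det y = det x = t`
  have hxu : IsUnit x.det := by rw [hdetx, hτ]; exact Units.isUnit t
  obtain ⟨xu, hxuval⟩ : ∃ xu : GL (Fin 2) (LocalRing L v), xu.val = x := ⟨Matrix.nonsingInvUnit x hxu, rfl⟩
  have hyval : (Pv * xu * Pv⁻¹).val = Pv.val * x * (Pv⁻¹).val := by rw [Units.val_mul, Units.val_mul, hxuval]
  refine ⟨⟨Pv * xu * Pv⁻¹, (mem_quatLocalUnits_iff L Ha v _).2 (by rw [hyval]; exact hyD)⟩, Units.ext ?_⟩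
  have hPP : Pv.val.det * (Pv⁻¹).val.det = 1 := by rw [← Matrix.det_mul, ← Units.val_mul, mul_inv_cancel, Units.val_one, Matrix.det_one]
  rw [coe_quatLocalNrd, Subgroup.coe_mk, hyval, Matrix.det_mul, Matrix.det_mul, hdetx, hτ, mul_comm (Pv.val.det), mul_assoc, hPP, mul_one]

/-- **`Nrd((D_v)^×) = L⁺_vˣ` at every finite place `v` of `L⁺`**: the range of the local reduced norm ★ #3f-bis `quatLocalNrd` IS the group ★ `fixedUnits L v` of
`c ⊗ 1`-fixed units of `E_v` (`⊆`: ★ `range_quatLocalNrd_le_fixedUnits`; `⊇`: `exists_quatLocalNrd_eq`).  The matrix-model form of ★ #3h `localReducedNorm_surjective`.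
[cite: VignerasLNM800, Ch. II §1 p. 31 (3), Lemme 1.4] [cite: PlatonovRapinchuk1994, §1.4.3] -/
theorem range_quatLocalNrd_eq_fixedUnits (hHa : (Ha.map (cmConjRingHom L)).transpose = Ha) (hdet : Ha.det ≠ 0) :
    (quatLocalNrd L Ha v).range = fixedUnits L v :=
  le_antisymm (range_quatLocalNrd_le_fixedUnits L Ha v hdet) fun _ ht => by
    obtain ⟨y, hy⟩ := exists_quatLocalNrd_eq L Ha v hHa hdet ht
    exact ⟨y, hy⟩

/-- Surjectivity form: `Nrd` restricted onto `L⁺_vˣ` is onto. [cite: VignerasLNM800, Ch. II §1 p. 31 (3), Lemme 1.4] -/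
theorem quatLocalNrd_surjOn_fixedUnits (hHa : (Ha.map (cmConjRingHom L)).transpose = Ha) (hdet : Ha.det ≠ 0) :
    Set.SurjOn (quatLocalNrd L Ha v) Set.univ (fixedUnits L v : Set (LocalRing L v)ˣ) := fun _ ht => by
  obtain ⟨y, hy⟩ := exists_quatLocalNrd_eq L Ha v hHa hdet ht
  exact ⟨y, Set.mem_univ _, hy⟩

end Local

end Summit.HodgeConjecture.HodgeConjecture.Cruxes.H413.K2E5QuatLocalNrdSurjective

end
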